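import Mathlib
import HarnessLib
import Literature.MathematicalPhysics.KineticTheory.HardSphereEuler
import Literature.MathematicalPhysics.KineticTheory.BackwardCluster

/-!
# The hot path-length tail from a tilted first-moment bound on simple collision chains (reduction of
the stub `stub_hotPathLengthTail` of the line `Sketch` for the crux `RelayRaceLocality.GibbsLightCone`,
stmt-AtomisticToContinuum-12501)

Helper file (`--supports stmt-AtomisticToContinuum-12501`). The registered stub `stub_hotPathLengthTail`
(HOT PATH-LENGTH TAIL of skeleton revision 6) asks: under the invariant Gibbs law of `N + 1` hard
spheres of diameter `ε_N = σ (N+1)^{-1/3}` on `𝕋³`, for some absolute speed threshold `A√θ`, the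
probability that SOME simple collision chain `q 0, …, q k = p` into the tagged particle `p`, with
strictly increasing hand-over times inside the window `[0, M τ_N]` (`τ_N = ℓ_N/√θ`,
`ℓ_N = (N+1)^{-1/3}/σ²`), has HOT path length `H = Σ_m ∫_{T m}^{T (m+1)} ‖v_{q m}‖·1{A√θ < ‖v_{q m}‖}`
exceeding `λ M ℓ_N` is `≤ C e^{-cM}` for `1 ≤ M ≤ K log(N+2)`, eventually in `N`.

This file PROVES that tail from the currency every spine / many-to-one / Lanford-lineage engine
produces (cards `spine-eigenvalue-ibf`, `uniform-baton-spine`, `cold-budget-hot-needles`): a TILTED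
FIRST-MOMENT BOUND ON SIMPLE CHAIN COUNTS (`hotPathLengthTail_of_simpleChainHotCountBound`,
hypothesis `hCount`) — the expected number of injective label sequences `q : Fin (n+1) → Fin (N+1)`
ending at `p` that are realised as a collision chain with `n` links over the window AND have hot
path length `> y ℓ_N` is at most `C₀ e^{c₁ M} ρⁿ e^{-c₂ y}` (`0 ≤ ρ < 1`, `c₂ > 0`; heuristically
`ρⁿ` from the Poisson budget of time-ordered links and `e^{-c₂ y}` from `≥ 2 log A - O(1)` nats per
hot flight of length `≍ ℓ_N`). Deduction: union bound over the number of links (countable) and the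
label sequences (finite), `λ := (|c₁| + 1)/c₂`, geometric sum `Σₙ ρⁿ = (1 - ρ)⁻¹`, giving
`C = |C₀| (1 - ρ)⁻¹`, `c = 1`.

The tilted first-moment bound itself is NOT proved here (nor anywhere in print at fixed reduced
density over `K log N` mean free times): it is the cross-time ("seam") input of the hot sector. Its
untilted twin (`y` absent) is the hypothesis of `linkCountTail_of_simpleChainCountBound`
(`RelayRaceLocalityGibbsLightConeLinkCountBridge.lean`).
-/

namespace Summit.AtomisticToContinuum.HydrodynamicLimit.Theorems.LogWindowTaggedTail

open Literature.MathematicalPhysics.KineticTheory Literature.Analysis.FluidPDE MeasureTheory Filter Set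

open scoped ENNReal

/-- **THE HOT PATH-LENGTH TAIL FROM A TILTED FIRST-MOMENT BOUND ON SIMPLE CHAIN COUNTS.** If, under
the invariant Gibbs law, for some threshold `A ≥ 0` the expected number of injective label sequences
`q 0, …, q n = p` realised as a collision chain with `n` links into `p` over the window `[0, M τ_N]`
whose hot path length (speeds above `A√θ`) exceeds `y ℓ_N` is at most `C₀ e^{c₁ M} ρⁿ e^{-c₂ y}`
(`0 ≤ ρ < 1`, `0 < c₂`), for all `n` and `y ≥ 0`, `1 ≤ M ≤ K log(N+2)`, eventually in `N`
(hypothesis `hCount`, the cross-time input), then the registered stub `stub_hotPathLengthTail` holds.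
Union bound over `(k, q)` and a geometric sum. [folklore] -/
theorem hotPathLengthTail_of_simpleChainHotCountBound :
    (∀ a θ : ℝ, 0 < a → 0 < θ → ∃ σ₀ : ℝ, 0 < σ₀ ∧ ∃ A C₀ c₁ ρ c₂ : ℝ, 0 ≤ A ∧ 0 ≤ ρ ∧ ρ < 1 ∧
      0 < c₂ ∧ ∀ K : ℝ, 0 < K → ∀ σ : ℝ, 0 < σ → σ < σ₀ →
      ∀ Φ : (N : ℕ) → HardSphereFlow (Torus.geometry (Fin 3)) (hsDiameter σ N) (N + 1),
      ∀ᶠ N in atTop, ∀ p : Fin (N + 1), ∀ M : ℝ, 1 ≤ M → M ≤ K * Real.log ((N : ℝ) + 2) →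
        ∀ n : ℕ, ∀ y : ℝ, 0 ≤ y → ∑ q : Fin (n + 1) → Fin (N + 1),
          localGibbsLaw σ (fun _ => a) (fun _ => 0) (fun _ => θ) N (Φ N)
            {z | q (Fin.last n) = p ∧ Function.Injective q ∧ ∃ T : Fin (n + 2) → ℝ, Monotone T ∧
                StrictMono (fun m : Fin n => T (Fin.castSucc (Fin.succ m))) ∧ T 0 = 0 ∧
                T (Fin.last (n + 1)) = M * (((N + 1 : ℕ) : ℝ) ^ (-(1 / 3 : ℝ)) / σ ^ 2 / Real.sqrt θ) ∧
                (∀ m : Fin n, s(q (Fin.castSucc m), q (Fin.succ m)) ∈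
                  contactPairSet (Torus.geometry (Fin 3)) (hsDiameter σ N)
                    ((Φ N).flow (T (Fin.castSucc (Fin.succ m))) z)) ∧
                y * (((N + 1 : ℕ) : ℝ) ^ (-(1 / 3 : ℝ)) / σ ^ 2) <
                  ∑ m : Fin (n + 1), ∫ u in T (Fin.castSucc m)..T (Fin.succ m),
                    (if A * Real.sqrt θ < ‖(((Φ N).flow u z) (q m)).2‖ then
                      ‖(((Φ N).flow u z) (q m)).2‖ else 0)}
          ≤ ENNReal.ofReal (C₀ * Real.exp (c₁ * M) * ρ ^ n * Real.exp (-c₂ * y))) →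
    ∀ a θ : ℝ, 0 < a → 0 < θ → ∃ σ₀ : ℝ, 0 < σ₀ ∧ ∃ A lam c C : ℝ, 0 ≤ A ∧ 0 < c ∧ ∀ K : ℝ, 0 < K →
      ∀ σ : ℝ, 0 < σ → σ < σ₀ →
      ∀ Φ : (N : ℕ) → HardSphereFlow (Torus.geometry (Fin 3)) (hsDiameter σ N) (N + 1),
      ∀ᶠ N in atTop, ∀ p : Fin (N + 1), ∀ M : ℝ, 1 ≤ M → M ≤ K * Real.log ((N : ℝ) + 2) →
        localGibbsLaw σ (fun _ => a) (fun _ => 0) (fun _ => θ) N (Φ N)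
          {z | ∃ (k : ℕ) (q : Fin (k + 1) → Fin (N + 1)) (T : Fin (k + 2) → ℝ),
              q (Fin.last k) = p ∧ Function.Injective q ∧ Monotone T ∧
              StrictMono (fun m : Fin k => T (Fin.castSucc (Fin.succ m))) ∧ T 0 = 0 ∧
              T (Fin.last (k + 1)) = M * (((N + 1 : ℕ) : ℝ) ^ (-(1 / 3 : ℝ)) / σ ^ 2 / Real.sqrt θ) ∧
              (∀ m : Fin k, s(q (Fin.castSucc m), q (Fin.succ m)) ∈
                contactPairSet (Torus.geometry (Fin 3)) (hsDiameter σ N)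
                  ((Φ N).flow (T (Fin.castSucc (Fin.succ m))) z)) ∧
              lam * M * (((N + 1 : ℕ) : ℝ) ^ (-(1 / 3 : ℝ)) / σ ^ 2) <
                ∑ m : Fin (k + 1), ∫ u in T (Fin.castSucc m)..T (Fin.succ m),
                  (if A * Real.sqrt θ < ‖(((Φ N).flow u z) (q m)).2‖ then
                    ‖(((Φ N).flow u z) (q m)).2‖ else 0)}
          ≤ ENNReal.ofReal (C * Real.exp (-c * M)) := by
  intro hCount a θ ha hθ
  obtain ⟨σ₀, hσ₀, A, C₀, c₁, ρ, c₂, hA, hρ0, hρ1, hc₂, H⟩ := hCount a θ ha hθ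
  -- constants
  set b : ℝ := |c₁| with hb
  set lam : ℝ := (b + 1) / c₂ with hlam
  have hlam0 : 0 ≤ lam := div_nonneg (by positivity) hc₂.le
  refine ⟨σ₀, hσ₀, A, lam, 1, |C₀| * (1 - ρ)⁻¹, hA, one_pos, ?_⟩
  intro K hK σ hσ hσσ₀ Φ
  filter_upwards [H K hK σ hσ hσσ₀ Φ] with N hN p M hM hMK
  -- abbreviations
  set ℓ : ℝ := ((N + 1 : ℕ) : ℝ) ^ (-(1 / 3 : ℝ)) / σ ^ 2 with hℓ
  set W : ℝ := M * (((N + 1 : ℕ) : ℝ) ^ (-(1 / 3 : ℝ)) / σ ^ 2 / Real.sqrt θ) with hW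
  set P := localGibbsLaw σ (fun _ => a) (fun _ => 0) (fun _ => θ) N (Φ N) with hP
  have hM0 : 0 ≤ M := by linarith
  have hy : 0 ≤ lam * M := mul_nonneg hlam0 hM0
  -- the events of the tilted first-moment bound at level `y = λ M`
  set E : (k : ℕ) → (Fin (k + 1) → Fin (N + 1)) → Set (Config (N + 1) (Fin 3) T3) := fun k q =>
    {z | q (Fin.last k) = p ∧ Function.Injective q ∧ ∃ T : Fin (k + 2) → ℝ, Monotone T ∧
        StrictMono (fun m : Fin k => T (Fin.castSucc (Fin.succ m))) ∧ T 0 = 0 ∧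
        T (Fin.last (k + 1)) = W ∧
        (∀ m : Fin k, s(q (Fin.castSucc m), q (Fin.succ m)) ∈
          contactPairSet (Torus.geometry (Fin 3)) (hsDiameter σ N)
            ((Φ N).flow (T (Fin.castSucc (Fin.succ m))) z)) ∧
        lam * M * ℓ <
          ∑ m : Fin (k + 1), ∫ u in T (Fin.castSucc m)..T (Fin.succ m),
            (if A * Real.sqrt θ < ‖(((Φ N).flow u z) (q m)).2‖ then
              ‖(((Φ N).flow u z) (q m)).2‖ else 0)} with hE
  -- the dominating sequence
  set g : ℕ → ℝ := fun k => |C₀| * Real.exp (-M) * ρ ^ k with hg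
  have hg_nonneg : ∀ k, 0 ≤ g k := fun k => by positivity
  have hg_summ : Summable g := (summable_geometric_of_lt_one hρ0 hρ1).mul_left _
  -- the real bound of the first-moment hypothesis is dominated by `g`
  have hkey : Real.exp (c₁ * M) * Real.exp (-c₂ * (lam * M)) ≤ Real.exp (-M) := by
    rw [← Real.exp_add]
    refine Real.exp_le_exp.2 ?_
    have h1 : c₂ * (lam * M) = (b + 1) * M := by
      rw [hlam]
      field_simp
    have h2 : c₁ * M ≤ b * M := mul_le_mul_of_nonneg_right (le_abs_self _) hM0
    nlinarith
  have hdom : ∀ k : ℕ, C₀ * Real.exp (c₁ * M) * ρ ^ k * Real.exp (-c₂ * (lam * M)) ≤ g k := by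
    intro k
    have h1 : C₀ * Real.exp (c₁ * M) * ρ ^ k * Real.exp (-c₂ * (lam * M)) ≤
        |C₀| * Real.exp (c₁ * M) * ρ ^ k * Real.exp (-c₂ * (lam * M)) := by
      gcongr
      exact le_abs_self _
    have h2 : |C₀| * Real.exp (c₁ * M) * ρ ^ k * Real.exp (-c₂ * (lam * M)) =
        |C₀| * ρ ^ k * (Real.exp (c₁ * M) * Real.exp (-c₂ * (lam * M))) := by ring
    have h3 : g k = |C₀| * ρ ^ k * Real.exp (-M) := by
      simp only [hg]
      ring
    rw [h2] at h1
    rw [h3]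
    exact le_trans h1 (mul_le_mul_of_nonneg_left hkey (by positivity))
  -- per number of links: union over the label sequences
  have hk : ∀ k : ℕ, P (⋃ q : Fin (k + 1) → Fin (N + 1), E k q) ≤ ENNReal.ofReal (g k) := by
    intro k
    calc P (⋃ q : Fin (k + 1) → Fin (N + 1), E k q)
        ≤ ∑ q : Fin (k + 1) → Fin (N + 1), P (E k q) := measure_iUnion_fintype_le P _
      _ ≤ ENNReal.ofReal (C₀ * Real.exp (c₁ * M) * ρ ^ k * Real.exp (-c₂ * (lam * M))) :=
          hN p M hM hMK k (lam * M) hy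
      _ ≤ ENNReal.ofReal (g k) := ENNReal.ofReal_le_ofReal (hdom k)
  -- the stub event is covered by the events of the first-moment bound
  have hsub : {z | ∃ (k : ℕ) (q : Fin (k + 1) → Fin (N + 1)) (T : Fin (k + 2) → ℝ),
      q (Fin.last k) = p ∧ Function.Injective q ∧ Monotone T ∧
      StrictMono (fun m : Fin k => T (Fin.castSucc (Fin.succ m))) ∧ T 0 = 0 ∧
      T (Fin.last (k + 1)) = W ∧
      (∀ m : Fin k, s(q (Fin.castSucc m), q (Fin.succ m)) ∈
        contactPairSet (Torus.geometry (Fin 3)) (hsDiameter σ N)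
          ((Φ N).flow (T (Fin.castSucc (Fin.succ m))) z)) ∧
      lam * M * ℓ <
        ∑ m : Fin (k + 1), ∫ u in T (Fin.castSucc m)..T (Fin.succ m),
          (if A * Real.sqrt θ < ‖(((Φ N).flow u z) (q m)).2‖ then
            ‖(((Φ N).flow u z) (q m)).2‖ else 0)} ⊆
      ⋃ k : ℕ, ⋃ q : Fin (k + 1) → Fin (N + 1), E k q := by
    rintro z ⟨k, q, T, hqk, hinj, hmono, hsm, hT0, hTl, hlink, hdist⟩
    exact Set.mem_iUnion.2 ⟨k, Set.mem_iUnion.2 ⟨q, hqk, hinj, T, hmono, hsm, hT0, hTl, hlink, hdist⟩⟩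
  refine le_trans (measure_mono hsub) ?_
  refine le_trans (measure_iUnion_le _) ?_
  refine le_trans (ENNReal.tsum_le_tsum hk) ?_
  rw [← ENNReal.ofReal_tsum_of_nonneg hg_nonneg hg_summ]
  refine ENNReal.ofReal_le_ofReal ?_
  -- the geometric sum
  have htsum : ∑' k, g k = |C₀| * Real.exp (-M) * (1 - ρ)⁻¹ := by
    simp only [hg]
    rw [tsum_mul_left, tsum_geometric_of_lt_one hρ0 hρ1]
  rw [htsum]
  have : |C₀| * Real.exp (-M) * (1 - ρ)⁻¹ = |C₀| * (1 - ρ)⁻¹ * Real.exp (-1 * M) := by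
    rw [neg_one_mul]
    ring
  rw [this]

end Summit.AtomisticToContinuum.HydrodynamicLimit.Theorems.LogWindowTaggedTail
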